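import Literature.AlgebraicGeometry.Limits.SubalgebraSpread
import Literature.AlgebraicGeometry.Motives.BaseChange
import Mathlib.SetTheory.Cardinal.Subfield
import HarnessLib

/-!
# Families of finite type over `ℂ` are defined over a countable subfield (EGA IV₃ 8.8.2 (ii); Voisin 2007, §3)

Topic: `Literature/AlgebraicGeometry/Limits` (Noetherian approximation, EGA IV₃ §8). For a morphism
`f : 𝒳 ⟶ S` of `ℂ`-schemes with `S` separated of finite type over `ℂ` and `f` separated of finite
type, **there are a COUNTABLE subfield `k ⊆ ℂ` (with its inclusion `σ : k →+* ℂ`), `k`-schemes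
`𝒳₀`, `S₀`, a `k`-morphism `f₀ : 𝒳₀ ⟶ S₀` and an isomorphism of families
`(f₀ ⊗_{k,σ} ℂ : 𝒳₀ ⊗_σ ℂ ⟶ S₀ ⊗_σ ℂ) ≅ (f : 𝒳 ⟶ S)` over `ℂ`** (`exists_countable_subfield_descent`:
isomorphisms `e𝒳 : (baseChangeHom σ).obj 𝒳₀ ≅ 𝒳`, `eS : (baseChangeHom σ).obj S₀ ≅ S` with
`(baseChangeHom σ).map f₀ ≫ eS.hom = e𝒳.hom ≫ f`). This is the standard first sentence of every
"spreading out" argument in Hodge theory — "`𝒳, π, T` are defined over a field `k` which is finitely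
generated over `ℚ`, hence countable" (Voisin, *Hodge loci and absolute Hodge classes*, Compositio 143
(2007), §3, proof of Prop. 1.2; Charles–Schnell, *Notes on absolute Hodge classes* (2014), §11.3.5) —
as a consequence of EGA IV₃ Thm. 8.8.2 (ii) / The Stacks Project, Tag 01ZM.

## Proof

All the algebraic geometry is in the tree already (`Limits/FiniteTypeModelDescent`,
`Limits/SubalgebraSpread`): (1) `S → Spec ℂ` is the base change of a separated scheme of finite type
`S₁ → Spec R₁` over a finitely generated `ℚ`-subalgebra `R₁ ⊆ ℂ`
(`Limits.exists_isPullback_specMap_subalgebra`); (2) the morphism `𝒳 → S = S₁ ×_{R₁} Spec ℂ` is the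
base change of a separated morphism of finite type `X' → S₁ ×_{R₁} Spec R` for an `R₁`-algebra `R`
of finite type with an injective `R₁`-algebra map `ψ : R → ℂ`
(`Limits.exists_isPullback_whisker_of_hom_tensorObj`); (3) `k := ` the subfield of `ℂ` generated by
`ψ(R)` is countable (`R` is of finite type over `ℚ`; `Subfield.cardinalMk_closure_le_max`), `ψ`
factors through `k`, and base-changing `X' → S₁ ×_{R₁} Spec R` along `Spec k → Spec R` gives the
`k`-family `f₀`; (4) pasting of cartesian squares (`IsPullback.of_right`, `IsPullback.paste_vert`)
identifies `f₀ ⊗_σ ℂ` with `f`. Everything is proved; no definitions, no named facts.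

## References

* [EGAIV3] A. Grothendieck, J. Dieudonné, EGA IV₃, Publ. Math. IHÉS 28 (1966), Thm. 8.8.2 (ii).
* [StacksProject] The Stacks Project, Tag 01ZM.
* [Voisin2007HodgeLoci] C. Voisin, Hodge loci and absolute Hodge classes, Compositio Math. 143
  (2007), §3 (proof of Prop. 1.2, first paragraph).
* [CharlesSchnell2014Notes] F. Charles, C. Schnell, Notes on absolute Hodge classes (2014), §11.3.5.
-/

noncomputable section

open CategoryTheory CategoryTheory.Limits AlgebraicGeometry MonoidalCategory Cardinal

universe u

namespace Literature.AlgebraicGeometry.Limits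

open Literature.AlgebraicGeometry.Motives

/-- An algebra of finite type over a countable commutative ring is countable (it is a quotient of a
polynomial ring in finitely many variables). [folklore] -/
private theorem countable_of_finiteType (K A : Type u) [CommRing K] [Countable K] [CommRing A] [Algebra K A]
    [Algebra.FiniteType K A] : Countable A := by
  obtain ⟨n, g, hg⟩ := Algebra.FiniteType.iff_quotient_mvPolynomial''.mp ‹Algebra.FiniteType K A›
  have hA : #A ≤ ℵ₀ := by
    refine (Cardinal.mk_le_of_surjective hg).trans (MvPolynomial.cardinalMk_le_max_lift.trans ?_)
    exact max_le (max_le (by simp) (by simp)) le_rfl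
  exact Cardinal.mk_le_aleph0_iff.mp hA

/-- The subfield of a field generated by the range of a map from a countable type is countable
(`#(closure s) ≤ max #s ℵ₀`). [folklore] -/
private theorem countable_subfieldClosure_range {L : Type*} [Field L] {R : Type*} [Countable R] (ψ : R → L) :
    Countable (Subfield.closure (Set.range ψ)) := by
  have h : #(Subfield.closure (Set.range ψ)) ≤ ℵ₀ := by
    refine (Subfield.cardinalMk_closure_le_max _).trans (max_le ?_ le_rfl)
    haveI : Countable (Set.range ψ) := (Set.countable_range ψ).to_subtype
    exact mk_le_aleph0
  exact Cardinal.mk_le_aleph0_iff.mp h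

/-- Over a Noetherian affine base, locally of finite type implies locally of finite presentation
(Hilbert: finitely generated algebras over a Noetherian ring are finitely presented). [folklore] -/
private theorem locallyOfFinitePresentation_of_isNoetherianRing {A : Type*} [CommRing A] [IsNoetherianRing A]
    {Y : Scheme} (g : Y ⟶ Spec (.of A)) [LocallyOfFiniteType g] : LocallyOfFinitePresentation g := by
  rw [HasRingHomProperty.iff_appLE (P := @LocallyOfFinitePresentation)]
  intro U V e
  haveI := IsLocallyNoetherian.component_noetherian (X := Spec (.of A)) U
  exact RingHom.FinitePresentation.of_finiteType.mp
    (HasRingHomProperty.appLE @LocallyOfFiniteType g inferInstance U V e)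

/-- **A family of finite type over `ℂ` is defined over a countable subfield** (EGA IV₃ 8.8.2 (ii);
Voisin 2007, §3: "`𝒳, π, T` are defined over a field finitely generated over `ℚ`"). For `ℂ`-schemes
`𝒳`, `S` with `S` separated of finite type over `ℂ` and a separated morphism of finite type
`f : 𝒳 ⟶ S`, there are a countable field `k`, a ring homomorphism `σ : k →+* ℂ` (the inclusion of a
subfield), `k`-schemes `𝒳₀`, `S₀`, a `k`-morphism `f₀ : 𝒳₀ ⟶ S₀` and isomorphisms of `ℂ`-schemes
`e𝒳 : 𝒳₀ ⊗_σ ℂ ≅ 𝒳`, `eS : S₀ ⊗_σ ℂ ≅ S` intertwining `f₀ ⊗_σ ℂ` and `f`.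
[cite: EGAIV3, Thm. 8.8.2 (ii)] [cite: Voisin2007HodgeLoci, §3, proof of Prop. 1.2] -/
theorem exists_countable_subfield_descent {𝒳 S : SchemeOver ℂ} (f : 𝒳 ⟶ S)
    [IsSeparated S.hom] [LocallyOfFiniteType S.hom] [QuasiCompact S.hom]
    [IsSeparated f.left] [LocallyOfFiniteType f.left] [QuasiCompact f.left] :
    ∃ (k : Type) (_ : Field k) (_ : Countable k) (σ : k →+* ℂ) (𝒳₀ S₀ : SchemeOver k)
      (f₀ : 𝒳₀ ⟶ S₀) (e𝒳 : (baseChangeHom σ).obj 𝒳₀ ≅ 𝒳) (eS : (baseChangeHom σ).obj S₀ ≅ S),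
      (baseChangeHom σ).map f₀ ≫ eS.hom = e𝒳.hom ≫ f := by
  classical
  -- (1) the base `S` comes from a finitely generated `ℚ`-subalgebra `R₁ ⊆ ℂ`
  obtain ⟨R₁, S₁, p₁, πS, hfg, hsep, hlft, hqc, hsqS⟩ :=
    exists_isPullback_specMap_subalgebra (K := ℚ) S.hom
  haveI := hsep
  haveI := hlft
  haveI := hqc
  haveI hK₁ft : Algebra.FiniteType ℚ R₁ := ⟨(Subalgebra.fg_top R₁).mpr hfg⟩
  haveI : IsNoetherianRing R₁ := Algebra.FiniteType.isNoetherianRing ℚ R₁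
  -- the `R₁`-scheme `P = (S₁ → Spec R₁)`
  let P : SchemeOver R₁ := Over.mk p₁
  haveI : QuasiCompact P.hom := hqc
  haveI : IsSeparated P.hom := hsep
  haveI : LocallyOfFiniteType P.hom := hlft
  haveI : LocallyOfFinitePresentation P.hom := locallyOfFinitePresentation_of_isNoetherianRing p₁
  -- the projections of `S₁ ×_{R₁} Spec ℂ`
  let fstℂ : (P ⊗ specOver R₁ ℂ).left ⟶ P.left := pullback.fst P.hom (specOver R₁ ℂ).hom
  let qℂ : (P ⊗ specOver R₁ ℂ).left ⟶ Spec (.of ℂ) := pullback.snd P.hom (specOver R₁ ℂ).hom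
  have tℂ : IsPullback fstℂ qℂ P.hom (specOver R₁ ℂ).hom := IsPullback.of_hasPullback _ _
  -- `S ≅ S₁ ×_{R₁} Spec ℂ`
  have hsqS' : IsPullback πS S.hom P.hom (specOver R₁ ℂ).hom := hsqS
  let eS₁ : S.left ≅ (P ⊗ specOver R₁ ℂ).left := hsqS'.isoPullback
  have heS₁_snd : eS₁.hom ≫ qℂ = S.hom := hsqS'.isoPullback_hom_snd
  -- (2) the morphism `𝒳 → S₁ ×_{R₁} Spec ℂ` comes from a stage `R`
  let a : 𝒳.left ⟶ (P ⊗ specOver R₁ ℂ).left := f.left ≫ eS₁.hom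
  haveI : IsSeparated a := inferInstance
  haveI : LocallyOfFiniteType a := inferInstance
  haveI : QuasiCompact a := inferInstance
  obtain ⟨R, _, _, ψ, X', G, π, ℓ, -, hRft, -, -, -, hℓ₁, hℓ₂, hsq𝒳⟩ :=
    exists_isPullback_whisker_of_hom_tensorObj P a
  haveI := hRft
  -- the projections of `S₁ ×_{R₁} Spec R`
  let fstR : (P ⊗ specOver R₁ R).left ⟶ P.left := pullback.fst P.hom (specOver R₁ R).hom
  let qR : (P ⊗ specOver R₁ R).left ⟶ Spec (.of R) := pullback.snd P.hom (specOver R₁ R).hom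
  have tR : IsPullback fstR qR P.hom (specOver R₁ R).hom := IsPullback.of_hasPullback _ _
  have hℓ₁' : ℓ ≫ fstR = fstℂ := hℓ₁
  have hℓ₂' : ℓ ≫ qR = qℂ ≫ Spec.map (CommRingCat.ofHom ψ.toRingHom) := hℓ₂
  -- (3) the countable subfield `k = ℚ(ψ(R)) ⊆ ℂ`
  haveI : Countable R₁ := countable_of_finiteType ℚ R₁
  haveI : Countable R := countable_of_finiteType R₁ R
  let k : Subfield ℂ := Subfield.closure (Set.range ψ)
  haveI : Countable k := countable_subfieldClosure_range ψ
  let σ : k →+* ℂ := k.subtype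
  let ψk : R →+* k := ψ.toRingHom.codRestrict k fun r => Subfield.subset_closure ⟨r, rfl⟩
  have hσψk : σ.comp ψk = ψ.toRingHom := RingHom.ext fun _ => rfl
  have hSpecψ : Spec.map (CommRingCat.ofHom ψ.toRingHom) =
      Spec.map (CommRingCat.ofHom σ) ≫ Spec.map (CommRingCat.ofHom ψk) := by
    rw [← Spec.map_comp, ← CommRingCat.ofHom_comp, hσψk]
  -- `ℓ : S₁ × Spec ℂ → S₁ × Spec R` is the base change of `Spec ψ`
  have hψalg : Spec.map (CommRingCat.ofHom ψ.toRingHom) ≫ (specOver R₁ R).hom =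
      (specOver R₁ ℂ).hom := by
    change Spec.map (CommRingCat.ofHom ψ.toRingHom) ≫
      Spec.map (CommRingCat.ofHom (algebraMap R₁ R)) = Spec.map (CommRingCat.ofHom (algebraMap R₁ ℂ))
    rw [← Spec.map_comp, ← CommRingCat.ofHom_comp, ψ.toRingHom_eq_coe, ψ.comp_algebraMap]
  have hℓcart : IsPullback ℓ qℂ qR (Spec.map (CommRingCat.ofHom ψ.toRingHom)) := by
    have B : IsPullback (ℓ ≫ fstR) qℂ P.hom
        (Spec.map (CommRingCat.ofHom ψ.toRingHom) ≫ (specOver R₁ R).hom) := by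
      rw [hℓ₁', hψalg]
      exact tℂ
    exact B.of_right hℓ₂' tR
  -- the `k`-schemes: `S₀ = (S₁ × Spec R) ×_R Spec k`, `𝒳₀ = X' ×_{S₁ × Spec R} S₀`
  let S₀ : SchemeOver k := Over.mk (pullback.snd qR (Spec.map (CommRingCat.ofHom ψk)))
  let prS : S₀.left ⟶ (P ⊗ specOver R₁ R).left := pullback.fst qR (Spec.map (CommRingCat.ofHom ψk))
  have tS : IsPullback prS S₀.hom qR (Spec.map (CommRingCat.ofHom ψk)) :=
    IsPullback.of_hasPullback qR (Spec.map (CommRingCat.ofHom ψk))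
  let f₀l' : pullback G prS ⟶ S₀.left := pullback.snd G prS
  let 𝒳₀ : SchemeOver k := Over.mk (f₀l' ≫ S₀.hom)
  let prX : 𝒳₀.left ⟶ X' := pullback.fst G prS
  let f₀l : 𝒳₀.left ⟶ S₀.left := pullback.snd G prS
  have tX : IsPullback prX f₀l G prS := IsPullback.of_hasPullback G prS
  let f₀ : 𝒳₀ ⟶ S₀ := Over.homMk f₀l rfl
  -- (4a) `S₁ × Spec ℂ → S₀` and its cartesian square over `Spec σ`
  let φS : (P ⊗ specOver R₁ ℂ).left ⟶ S₀.left :=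
    pullback.lift ℓ (qℂ ≫ Spec.map (CommRingCat.ofHom σ))
      (by rw [hℓcart.w, hSpecψ, Category.assoc])
  have hφS₁ : φS ≫ prS = ℓ := pullback.lift_fst _ _ _
  have hφS₂ : φS ≫ S₀.hom = qℂ ≫ Spec.map (CommRingCat.ofHom σ) := pullback.lift_snd _ _ _
  have hSleft : IsPullback φS qℂ S₀.hom (Spec.map (CommRingCat.ofHom σ)) := by
    have B : IsPullback (φS ≫ prS) qℂ qR
        (Spec.map (CommRingCat.ofHom σ) ≫ Spec.map (CommRingCat.ofHom ψk)) := by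
      rw [hφS₁, ← hSpecψ]
      exact hℓcart
    exact B.of_right hφS₂ tS
  have hS : IsPullback (eS₁.hom ≫ φS) S.hom S₀.hom (Spec.map (CommRingCat.ofHom σ)) := by
    have he : IsPullback eS₁.hom (eS₁.hom ≫ qℂ) qℂ (𝟙 _) :=
      IsPullback.of_horiz_isIso ⟨by rw [Category.comp_id]⟩
    have h := he.paste_horiz hSleft
    rw [Category.id_comp, heS₁_snd] at h
    exact h
  -- (4b) `𝒳 → 𝒳₀` and its cartesian square over `Spec σ`
  let φ𝒳 : 𝒳.left ⟶ 𝒳₀.left :=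
    pullback.lift π (a ≫ φS) (by rw [Category.assoc, hφS₁]; exact hsq𝒳.w)
  have hφ𝒳₁ : φ𝒳 ≫ prX = π := pullback.lift_fst _ _ _
  have hφ𝒳₂ : φ𝒳 ≫ f₀l = a ≫ φS := pullback.lift_snd _ _ _
  have h𝒳left : IsPullback φ𝒳 a f₀l φS := by
    have B : IsPullback (φ𝒳 ≫ prX) a G (φS ≫ prS) := by
      rw [hφ𝒳₁, hφS₁]
      exact hsq𝒳
    exact B.of_right hφ𝒳₂ tX
  have ha : a ≫ qℂ = 𝒳.hom := by
    change (f.left ≫ eS₁.hom) ≫ qℂ = 𝒳.hom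
    rw [Category.assoc, heS₁_snd, Over.w f]
  have h𝒳 : IsPullback φ𝒳 𝒳.hom 𝒳₀.hom (Spec.map (CommRingCat.ofHom σ)) := by
    have h := h𝒳left.paste_vert hSleft
    rw [ha] at h
    exact h
  -- the isomorphisms of `ℂ`-schemes
  let eS : (baseChangeHom σ).obj S₀ ≅ S :=
    Over.isoMk hS.isoPullback.symm hS.isoPullback_inv_snd
  let e𝒳 : (baseChangeHom σ).obj 𝒳₀ ≅ 𝒳 :=
    Over.isoMk h𝒳.isoPullback.symm h𝒳.isoPullback_inv_snd
  refine ⟨k, inferInstance, inferInstance, σ, 𝒳₀, S₀, f₀, e𝒳, eS, ?_⟩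
  -- compatibility with `f`: computed on the two projections of `S₀ ×_k Spec ℂ`
  let bcl : pullback 𝒳₀.hom (Spec.map (CommRingCat.ofHom σ)) ⟶
      pullback S₀.hom (Spec.map (CommRingCat.ofHom σ)) := ((baseChangeHom σ).map f₀).left
  have hbc₁ : bcl ≫ pullback.fst S₀.hom (Spec.map (CommRingCat.ofHom σ)) =
      pullback.fst 𝒳₀.hom (Spec.map (CommRingCat.ofHom σ)) ≫ f₀l :=
    baseChangeHom_map_left_comp_fst σ f₀
  have hbc₂ : bcl ≫ pullback.snd S₀.hom (Spec.map (CommRingCat.ofHom σ)) =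
      pullback.snd 𝒳₀.hom (Spec.map (CommRingCat.ofHom σ)) :=
    Over.w ((baseChangeHom σ).map f₀)
  have ha' : a ≫ φS = f.left ≫ eS₁.hom ≫ φS := Category.assoc _ _ _
  have H : h𝒳.isoPullback.hom ≫ bcl = f.left ≫ hS.isoPullback.hom := by
    apply pullback.hom_ext
    · rw [Category.assoc, Category.assoc, hS.isoPullback_hom_fst, hbc₁, ← Category.assoc,
        h𝒳.isoPullback_hom_fst, hφ𝒳₂, ha']
    · rw [Category.assoc, Category.assoc, hS.isoPullback_hom_snd, hbc₂, h𝒳.isoPullback_hom_snd,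
        Over.w f]
  ext : 1
  change bcl ≫ hS.isoPullback.inv = h𝒳.isoPullback.inv ≫ f.left
  rw [← cancel_epi h𝒳.isoPullback.hom, ← Category.assoc, H, Category.assoc, Iso.hom_inv_id,
    Category.comp_id, Iso.hom_inv_id_assoc]

end Literature.AlgebraicGeometry.Limits

end
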